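import Literature.Geometry.Lorentzian.SecondVariationArea
import Mathlib.Analysis.Calculus.LocalExtr.Basic
import HarnessLib

/-!
# Area-minimising immersed surfaces are stable (Schoen–Yau 1979, (2.13))

Schoen–Yau, Comm. Math. Phys. 65 (1979), §2, Step 3, p. 53: the complete area-minimising surface
`S` of Step 2 satisfies, "by stability", (2.13) `∫_S (Ric(ν,ν) + ‖A‖²) f² ≤ ∫_S ‖∇f‖²` for every
smooth `f` of compact support. This file proves the step *area-minimising ⟹ stable* for immersed
surfaces in a Riemannian `3`-manifold, from the first and second variation formulas of
`SecondVariationArea.lean` (Lawson 1980, Ch. I, Thms. 7.1–7.2):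

* `SurfaceVariation.nonneg_of_isLocalMin` — calculus: if `A' = A₁` everywhere, `A₁' (t₀) = A₂`
  and `A` has a local minimum at `t₀`, then `0 ≤ A₂`;
* `SurfaceVariation.setIntegral_secondVariation_nonneg_of_isLocalMin` — **the second variation
  inequality**: for a smooth family of immersions `F` with normal variation field
  `∂ₜF(t₀, ·) = f ν`, a second smooth family `G` through `G 0 = F t₀` whose variation field is
  the acceleration field `a = D_t ∂ₜF(t₀, ·)` of `F`, and a compact `K ⊆ S` such that BOTH
  `t ↦ μ_{F_t^*h}(K)` (at `t₀`) and `s ↦ μ_{G_s^*h}(K)` (at `0`) have local minima: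
  `0 ≤ ∫_K (‖∇f‖² − f²‖A‖² + f²H² − f² Ric(ν,ν)) dμ_{F_{t₀}^*h}` — the acceleration term
  `∑ᵢ h(D_{βᵢ} a, dF βᵢ)` of the second variation integrand is the first variation integrand of
  `G`, whose integral vanishes by the first-order condition for `G` (this is how the term
  `∫ div_S(∇_E E)` of Lawson's Thm. 7.2 is disposed of without a divergence theorem);
* `SurfaceVariation.stability_of_isLocalMin` — **(2.13) for a minimal immersion**: if moreover
  `H ≡ 0` then `∫_K (Ric(ν,ν) + ‖A‖²) f² dμ ≤ ∫_K ‖∇f‖² dμ`.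

The families `F`, `G` are produced from flows of compactly supported ambient vector fields in
`StabilityOfMinimizersFlow.lean`; here they are hypotheses. Everything is proved; no definitions,
no named facts.

## References

* R. Schoen, S.-T. Yau, Comm. Math. Phys. 65 (1979) 45–76, §2, (2.13), p. 53. [SchoenYauPMT1979]
* H. B. Lawson, *Lectures on minimal submanifolds*, Vol. I (1980), Ch. I §7, Thms. 7.1–7.2 and
  the stability inequality following Thm. 7.2.
* T. H. Colding, W. P. Minicozzi II, *A course in minimal surfaces*, GSM 121 (2011), §1.8.
-/

noncomputable section

open Bundle Set Manifold TopologicalSpace Filter Function MeasureTheory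
open scoped ContDiff Topology Manifold Matrix ENNReal

namespace Literature.Geometry.Lorentzian

open PseudoRiemannianMetric

namespace SurfaceVariation

/-! ### Calculus: the second-order condition at a local minimum -/

/-- **Second-order necessary condition at a local minimum.** If `A : ℝ → ℝ` has derivative `A₁ t`
at every `t`, `A₁` has derivative `A₂` at `t₀`, and `A` has a local minimum at `t₀`, then
`0 ≤ A₂`: otherwise `A₁(t₀) = 0` (Fermat) and `A₁ < 0` just to the right of `t₀` (limit of
difference quotients), so `A` decreases strictly there (mean value theorem). [folklore] -/
theorem nonneg_of_isLocalMin {A A₁ : ℝ → ℝ} {A₂ t₀ : ℝ} (hA : ∀ t, HasDerivAt A (A₁ t) t)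
    (hA₁ : HasDerivAt A₁ A₂ t₀) (hmin : IsLocalMin A t₀) : 0 ≤ A₂ := by
  by_contra hneg
  push Not at hneg
  have h0 : A₁ t₀ = 0 := hmin.hasDerivAt_eq_zero (hA t₀)
  -- `A₁ < 0` on a right neighbourhood of `t₀`
  have hslope := hA₁.tendsto_slope_zero_right
  have hev : ∀ᶠ s in 𝓝[>] (0 : ℝ), s⁻¹ • (A₁ (t₀ + s) - A₁ t₀) < 0 :=
    hslope (Iio_mem_nhds hneg)
  rw [Filter.Eventually, mem_nhdsGT_iff_exists_Ioo_subset] at hev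
  obtain ⟨δ, hδ, hδsub⟩ := hev
  have hneg' : ∀ s ∈ Ioo (0 : ℝ) δ, A₁ (t₀ + s) < 0 := by
    intro s hs
    have h1 : s⁻¹ • (A₁ (t₀ + s) - A₁ t₀) < 0 := hδsub hs
    rw [h0, sub_zero, smul_eq_mul] at h1
    have hs0 : 0 < s⁻¹ := inv_pos.2 hs.1
    nlinarith
  -- local minimality on a (two-sided) neighbourhood
  obtain ⟨ε, hε, hεmin⟩ : ∃ ε > 0, ∀ t, dist t t₀ < ε → A t₀ ≤ A t := by
    rcases Metric.eventually_nhds_iff.1 hmin with ⟨ε, hε, h⟩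
    exact ⟨ε, hε, fun t ht ↦ h ht⟩
  -- pick `t₁ = t₀ + s` with `s < min δ ε`
  set s : ℝ := min δ ε / 2 with hs
  have hs0 : 0 < s := by rw [hs]; exact half_pos (lt_min hδ hε)
  have hsδ : s < δ := by
    have : min δ ε ≤ δ := min_le_left _ _
    rw [hs]; linarith
  have hsε : s < ε := by
    have : min δ ε ≤ ε := min_le_right _ _
    rw [hs]; linarith
  -- mean value theorem on `[t₀, t₀ + s]`
  have hcont : ContinuousOn A (Icc t₀ (t₀ + s)) :=
    fun t _ ↦ (hA t).continuousAt.continuousWithinAt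
  obtain ⟨c, hc, hcslope⟩ := exists_hasDerivAt_eq_slope A A₁ (by linarith) hcont
    (fun t _ ↦ hA t)
  have hc' : c - t₀ ∈ Ioo (0 : ℝ) δ := ⟨by linarith [hc.1], by linarith [hc.2]⟩
  have hA₁c : A₁ c < 0 := by simpa using hneg' (c - t₀) hc'
  rw [hcslope] at hA₁c
  have hden : 0 < t₀ + s - t₀ := by linarith
  have hlt : A (t₀ + s) - A t₀ < 0 := by
    by_contra hge
    push Not at hge
    exact absurd (div_nonneg hge hden.le) (not_le.2 hA₁c)
  have hmin' := hεmin (t₀ + s) (by rw [Real.dist_eq]; simp [abs_of_pos hs0, hsε])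
  linarith

/-! ### The second variation inequality at an area-minimising immersion -/

variable {X : Type*} [TopologicalSpace X] [ChartedSpace E3 X] [IsManifold (𝓡 3) ∞ X]
  {h : ContMDiffRiemannianMetric (𝓡 3) ∞ E3 (TangentSpace (𝓡 3) : X → Type _)}
  [(ofRiemannian h).HasLeviCivita]
  {S : Type*} [TopologicalSpace S] [ChartedSpace (EuclideanSpace ℝ (Fin 2)) S]
  [IsManifold (𝓡 2) ∞ S] [T3Space S] [SecondCountableTopology S] [MeasurableSpace S] [BorelSpace S]
  {F G : ℝ → S → X} {F₀ : S → X} {hpb : contMDiff_pullbackBilin (𝓡 3) X (𝓡 2) S ∞}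
  {himm : ∀ t, (ofRiemannian h).IsSpacelikeImmersion (𝓡 2) (F t)}
  {himmG : ∀ t, (ofRiemannian h).IsSpacelikeImmersion (𝓡 2) (G t)}
  {hfi : (ofRiemannian h).IsSpacelikeImmersion (𝓡 2) F₀}
  {t₀ : ℝ} {ν : NormalField (𝓡 3) F₀} {f : S → ℝ}

omit [IsManifold (𝓡 2) ∞ S] [T3Space S] [SecondCountableTopology S] [MeasurableSpace S]
  [BorelSpace S] in
/-- Transport of the tangential divergence `∑ᵢ h(D_{βᵢ} E, df βᵢ)` along an equality of maps and a
pointwise equality of fields along them. [folklore] -/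
theorem sum_val_normalDerivAlong_congr {f₁ f₂ : S → X} {E₁ : NormalField (𝓡 3) f₁}
    {E₂ : NormalField (𝓡 3) f₂} (hf : f₁ = f₂) (hE : ∀ y, (E₁ y : E3) = E₂ y) (p : S)
    (β : Module.Basis (Fin 2) ℝ (TangentSpace (𝓡 2) p)) :
    ∑ i, (ofRiemannian h).val (f₁ p) ((ofRiemannian h).normalDerivAlong f₁ E₁ p (β i))
        (mfderiv (𝓡 2) (𝓡 3) f₁ p (β i)) =
      ∑ i, (ofRiemannian h).val (f₂ p) ((ofRiemannian h).normalDerivAlong f₂ E₂ p (β i))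
        (mfderiv (𝓡 2) (𝓡 3) f₂ p (β i)) := by
  subst hf
  have : E₁ = E₂ := funext hE
  subst this
  rfl

/-- **The second variation inequality for an area-minimising immersion** (Lawson 1980, Ch. I,
Thm. 7.2 and the stability inequality; Schoen–Yau 1979, (2.13) with `H` retained). Let `F` be a
smooth family of immersions of the surface `S` into `(X, h)` with normal variation field
`∂ₜF(t₀, ·) = f ν` at `t₀` (`ν` a smooth unit normal along `F_{t₀}`, `f ∈ C¹(S)`), and `G` a second
smooth family of immersions with `G 0 = F t₀` whose variation field at `0` is the acceleration
field `a = D_t ∂ₜF(t₀, ·)` of `F`. If for a compact `K ⊆ S` the areas `t ↦ μ_{F_t^*h}(K)` and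
`s ↦ μ_{G_s^*h}(K)` have local minima at `t₀` and `0` respectively, then
`0 ≤ ∫_K (‖∇f‖² − f²‖A‖² + f²H² − f² Ric(ν,ν)) dμ_{F_{t₀}^*h}`. Proof: the second derivative of
the first area at `t₀` is `≥ 0` (`nonneg_of_isLocalMin` with `hasDerivAt_areaOn`,
`hasDerivAt_setIntegral_densityDeriv`) and equals `∫_K ∂ₜ² (dμ_t/dμ_{t₀})`, whose integrand is
`‖∇f‖² − f²‖A‖² + f²H² − f² Ric(ν,ν) + ∑ᵢ h(D_{βᵢ} a, dF βᵢ)` (`densityDeriv₂_eq_of_normal`); the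
last term is the first variation integrand of `G` (`densityDeriv_eq_of_orthonormal`), whose
integral is the derivative of the second area at `0`, zero by the first-order condition.
[cite: SchoenYauPMT1979, §2 (2.13), p. 53] -/
theorem setIntegral_secondVariation_nonneg_of_isLocalMin
    (hF : ContMDiff (𝓘(ℝ, ℝ).prod (𝓡 2)) (𝓡 3) ∞ (fun q : ℝ × S ↦ F q.1 q.2)) (hF0 : F t₀ = F₀)
    (hν : ContMDiff (𝓡 2) (𝓡 3).tangent ∞
      (fun y ↦ (TotalSpace.mk' E3 (F₀ y) (ν y) : TangentBundle (𝓡 3) X)))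
    (hun : (ofRiemannian h).IsUnitNormal (𝓡 2) F₀ ν 1)
    (hf : ContMDiff (𝓡 2) 𝓘(ℝ, ℝ) 1 f) (hvel : ∀ y, (tvelocity (𝓡 3) F t₀ y : E3) = f y • (ν y : E3))
    (hG : ContMDiff (𝓘(ℝ, ℝ).prod (𝓡 2)) (𝓡 3) ∞ (fun q : ℝ × S ↦ G q.1 q.2))
    (hG0 : G 0 = F₀)
    (haccel : ∀ y, (tvelocity (𝓡 3) G 0 y : E3) =
      acceleration (𝓡 3) (ofRiemannian h).leviCivita F t₀ y)
    {K : Set S} (hK : IsCompact K)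
    (hminF : IsLocalMin (areaOn hpb himm K) t₀) (hminG : IsLocalMin (areaOn hpb himmG K) 0) :
    Integrable (fun p ↦ ((ofRiemannian h).inducedMetric F₀ hpb hfi).gradSq f p
          - f p ^ 2 * ((ofRiemannian h).inducedMetric F₀ hpb hfi).normSq p
              ((ofRiemannian h).secondFundamentalForm (𝓡 2) F₀ ν p)
          + f p ^ 2 * (ofRiemannian h).meanCurvature F₀ hpb hfi ν p ^ 2
          - f p ^ 2 * (ofRiemannian h).ricci (F₀ p) (ν p) (ν p))
        ((riemannianMeasure ((ofRiemannian h).inducedRiemannianMetric F₀ hpb hfi)).restrict K) ∧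
      0 ≤ ∫ p in K, (((ofRiemannian h).inducedMetric F₀ hpb hfi).gradSq f p
          - f p ^ 2 * ((ofRiemannian h).inducedMetric F₀ hpb hfi).normSq p
              ((ofRiemannian h).secondFundamentalForm (𝓡 2) F₀ ν p)
          + f p ^ 2 * (ofRiemannian h).meanCurvature F₀ hpb hfi ν p ^ 2
          - f p ^ 2 * (ofRiemannian h).ricci (F₀ p) (ν p) (ν p))
        ∂riemannianMeasure ((ofRiemannian h).inducedRiemannianMetric F₀ hpb hfi) := by
  subst hF0
  change Integrable _ ((riemannianMeasure (metricAt hpb himm t₀)).restrict K) ∧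
    0 ≤ ∫ p in K, _ ∂riemannianMeasure (metricAt hpb himm t₀)
  have hvel' : ∀ y, tvelocity (𝓡 3) F t₀ y = f y • ν y := hvel
  set μ₀ := riemannianMeasure (metricAt hpb himm t₀) with hμ₀
  set Q : S → ℝ := fun p ↦ ((ofRiemannian h).inducedMetric (F t₀) hpb (himm t₀)).gradSq f p
    - f p ^ 2 * ((ofRiemannian h).inducedMetric (F t₀) hpb (himm t₀)).normSq p
        ((ofRiemannian h).secondFundamentalForm (𝓡 2) (F t₀) ν p)
    + f p ^ 2 * (ofRiemannian h).meanCurvature (F t₀) hpb (himm t₀) ν p ^ 2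
    - f p ^ 2 * (ofRiemannian h).ricci (F t₀ p) (ν p) (ν p) with hQ
  -- the measures of the two families at the common slice agree
  have hmetric : metricAt hpb himmG 0 = metricAt hpb himm t₀ := by
    have key : ∀ (f₁ : S → X) (h₁ : (ofRiemannian h).IsSpacelikeImmersion (𝓡 2) f₁), f₁ = F t₀ →
        (ofRiemannian h).inducedRiemannianMetric f₁ hpb h₁ =
          (ofRiemannian h).inducedRiemannianMetric (F t₀) hpb (himm t₀) := by
      rintro f₁ h₁ rfl; rfl
    exact key (G 0) (himmG 0) hG0
  -- pointwise: second variation integrand of `F` = `Q` + first variation integrand of `G`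
  have hpt : ∀ p, densityDeriv₂ hpb himm t₀ t₀ p = Q p + densityDeriv hpb himmG 0 0 p := by
    intro p
    obtain ⟨β, hβ⟩ := exists_orthonormal_basis_fin_two hpb (himm t₀) p
    have hβG : ∀ i j, (ofRiemannian h).val (G 0 p) (mfderiv (𝓡 2) (𝓡 3) (G 0) p (β i))
        (mfderiv (𝓡 2) (𝓡 3) (G 0) p (β j)) = if i = j then 1 else 0 := by
      rw [hG0]; exact hβ
    rw [densityDeriv₂_eq_of_normal hF t₀ hν hun hf hvel' p β hβ,
      densityDeriv_eq_of_orthonormal hG 0 p β hβG,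
      sum_val_normalDerivAlong_congr (h := h) hG0 haccel p β]
  -- derivatives of the two area functions
  obtain ⟨-, hA⟩ : _ ∧ ∀ t, HasDerivAt (areaOn hpb himm K)
      (∫ p in K, densityDeriv hpb himm t₀ t p ∂μ₀) t :=
    ⟨trivial, fun t ↦ (hasDerivAt_areaOn hF t₀ hK t).2⟩
  obtain ⟨hint₂, hA₁⟩ := hasDerivAt_setIntegral_densityDeriv (hpb := hpb) (himm := himm) hF t₀ hK t₀
  have h2nd : 0 ≤ ∫ p in K, densityDeriv₂ hpb himm t₀ t₀ p ∂μ₀ := nonneg_of_isLocalMin hA hA₁ hminF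
  -- the first-order condition for `G`
  obtain ⟨hintG, hAG⟩ := hasDerivAt_areaOn (hpb := hpb) (himm := himmG) hG 0 hK 0
  rw [hmetric] at hintG hAG
  have h1st : ∫ p in K, densityDeriv hpb himmG 0 0 p ∂μ₀ = 0 := hminG.hasDerivAt_eq_zero hAG
  -- integrability of `Q`
  have hQeq : Q = fun p ↦ densityDeriv₂ hpb himm t₀ t₀ p - densityDeriv hpb himmG 0 0 p := by
    funext p; rw [hpt p]; ring
  have hintQ : Integrable Q (μ₀.restrict K) := by
    rw [hQeq]; exact hint₂.sub hintG
  refine ⟨hintQ, ?_⟩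
  have hsplit : ∫ p in K, densityDeriv₂ hpb himm t₀ t₀ p ∂μ₀ =
      ∫ p in K, Q p ∂μ₀ + ∫ p in K, densityDeriv hpb himmG 0 0 p ∂μ₀ := by
    rw [← integral_add hintQ hintG]
    exact integral_congr_ae (ae_of_all _ fun p ↦ hpt p)
  rw [hsplit, h1st, add_zero] at h2nd
  exact h2nd

/-- **Area-minimising minimal immersions are stable — Schoen–Yau 1979, (2.13).** In the setting of
`setIntegral_secondVariation_nonneg_of_isLocalMin`, if `F_{t₀}` is moreover minimal (`H ≡ 0`),
then `∫_K (Ric(ν,ν) + ‖A‖²) f² dμ ≤ ∫_K ‖∇f‖² dμ` for the induced measure of `F_{t₀}^*h`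
(Schoen–Yau, Comm. Math. Phys. 65 (1979), p. 53: "By stability we have for each smooth function
`f` with compact support on `S` (2.13)"; Lawson 1980, Ch. I, stability inequality after Thm. 7.2;
Colding–Minicozzi 2011, §1.8). [cite: SchoenYauPMT1979, §2 (2.13), p. 53] -/
theorem stability_of_isLocalMin
    (hF : ContMDiff (𝓘(ℝ, ℝ).prod (𝓡 2)) (𝓡 3) ∞ (fun q : ℝ × S ↦ F q.1 q.2)) (hF0 : F t₀ = F₀)
    (hν : ContMDiff (𝓡 2) (𝓡 3).tangent ∞
      (fun y ↦ (TotalSpace.mk' E3 (F₀ y) (ν y) : TangentBundle (𝓡 3) X)))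
    (hun : (ofRiemannian h).IsUnitNormal (𝓡 2) F₀ ν 1)
    (hmin : (ofRiemannian h).IsMaximalSlice F₀ hpb hfi ν)
    (hf : ContMDiff (𝓡 2) 𝓘(ℝ, ℝ) 1 f) (hvel : ∀ y, (tvelocity (𝓡 3) F t₀ y : E3) = f y • (ν y : E3))
    (hG : ContMDiff (𝓘(ℝ, ℝ).prod (𝓡 2)) (𝓡 3) ∞ (fun q : ℝ × S ↦ G q.1 q.2))
    (hG0 : G 0 = F₀)
    (haccel : ∀ y, (tvelocity (𝓡 3) G 0 y : E3) =
      acceleration (𝓡 3) (ofRiemannian h).leviCivita F t₀ y)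
    {K : Set S} (hK : IsCompact K)
    (hminF : IsLocalMin (areaOn hpb himm K) t₀) (hminG : IsLocalMin (areaOn hpb himmG K) 0) :
    Integrable (fun p ↦ ((ofRiemannian h).ricci (F₀ p) (ν p) (ν p) +
          ((ofRiemannian h).inducedMetric F₀ hpb hfi).normSq p
            ((ofRiemannian h).secondFundamentalForm (𝓡 2) F₀ ν p)) * f p ^ 2)
        ((riemannianMeasure ((ofRiemannian h).inducedRiemannianMetric F₀ hpb hfi)).restrict K) ∧
      ∫ p in K, ((ofRiemannian h).ricci (F₀ p) (ν p) (ν p) +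
          ((ofRiemannian h).inducedMetric F₀ hpb hfi).normSq p
            ((ofRiemannian h).secondFundamentalForm (𝓡 2) F₀ ν p)) * f p ^ 2
        ∂riemannianMeasure ((ofRiemannian h).inducedRiemannianMetric F₀ hpb hfi) ≤
      ∫ p in K, ((ofRiemannian h).inducedMetric F₀ hpb hfi).gradSq f p
        ∂riemannianMeasure ((ofRiemannian h).inducedRiemannianMetric F₀ hpb hfi) := by
  obtain ⟨hintQ, hQ⟩ := setIntegral_secondVariation_nonneg_of_isLocalMin (himmG := himmG) (hfi := hfi)
    hF hF0 hν hun hf hvel hG hG0 haccel hK hminF hminG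
  subst hF0
  set μ₀ := riemannianMeasure ((ofRiemannian h).inducedRiemannianMetric (F t₀) hpb hfi) with hμ₀
  set gN := (ofRiemannian h).inducedMetric (F t₀) hpb hfi with hgN
  haveI : IsFiniteMeasure (μ₀.restrict K) := by
    refine ⟨?_⟩
    rw [Measure.restrict_apply_univ]
    exact riemannianMeasure_lt_top_of_isCompact (hpb := hpb) (himm := himm) t₀ hK
  -- `‖∇f‖²` is continuous, hence integrable on `K`
  have hgrad_cont : Continuous fun p ↦ gN.gradSq f p :=
    continuous_innerDual_mvfderiv gN hf hf
  have hint_grad : Integrable (fun p ↦ gN.gradSq f p) (μ₀.restrict K) := by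
    obtain ⟨C, hC⟩ := hK.exists_bound_of_continuousOn hgrad_cont.continuousOn
    exact Integrable.of_bound hgrad_cont.aestronglyMeasurable C
      ((ae_restrict_iff' hK.measurableSet).2 (ae_of_all _ fun p hp ↦ hC p hp))
  -- with `H = 0` the integrand of `hQ` is `‖∇f‖² − (Ric + ‖A‖²) f²`
  have hH : ∀ p, (ofRiemannian h).meanCurvature (F t₀) hpb hfi ν p = 0 := hmin
  have heq : (fun p ↦ ((ofRiemannian h).ricci (F t₀ p) (ν p) (ν p) +
      gN.normSq p ((ofRiemannian h).secondFundamentalForm (𝓡 2) (F t₀) ν p)) * f p ^ 2) =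
      fun p ↦ gN.gradSq f p - (gN.gradSq f p
        - f p ^ 2 * gN.normSq p ((ofRiemannian h).secondFundamentalForm (𝓡 2) (F t₀) ν p)
        + f p ^ 2 * (ofRiemannian h).meanCurvature (F t₀) hpb hfi ν p ^ 2
        - f p ^ 2 * (ofRiemannian h).ricci (F t₀ p) (ν p) (ν p)) := by
    funext p; rw [hH p]; ring
  have hint : Integrable (fun p ↦ ((ofRiemannian h).ricci (F t₀ p) (ν p) (ν p) +
      gN.normSq p ((ofRiemannian h).secondFundamentalForm (𝓡 2) (F t₀) ν p)) * f p ^ 2)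
      (μ₀.restrict K) := by
    rw [heq]; exact hint_grad.sub hintQ
  refine ⟨hint, ?_⟩
  rw [heq, integral_sub hint_grad hintQ]
  linarith

end SurfaceVariation

end Literature.Geometry.Lorentzian

end
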